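import Summits.CriticalPhenomena.PercolationContinuityZ3.Theorems.PercNearOneGluingNoHeavyConstsCrossReachMarkerPinnedEventM1
import Summits.CriticalPhenomena.PercolationContinuityZ3.Theorems.PercNearOneGluingNoHeavyConstsSourceLocalFourEventsEdge
import HarnessLib

/-!
# CROSS at the marker `u = z`, marker-pinned class for EDGE up-sets: the three exchanges of the `M₁` certificate, and `M₁ ≥ 0` unconditionally
# (PAPER-2 track (ii), seat `prim-consts-2`, gen 21 — edge-cluster companion of `…ConstsCrossReachMarkerPinnedExchangesM1.lean`)

builds on p205010 (kernel theorem, internal audit signed; external expert review pending).  Support file (`--supports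
stmt-CriticalPhenomena-4575`); theorems only, no sorries, standard axioms.  Memo `run/shared/lean/prim/consts/FROM-prim-consts-2-g21-GIBBS-ORBIT.md` §3c.

`…ConstsCrossReachMarkerPinnedEventM1.lean` proves the CROSS member `M₁ ≥ 0` at `u = z` for `F(C_s) = 1_U`, `U ⊆ {s↔y}` an arbitrary configuration
event, from three exchange inequalities `hGa, hGc, hGe`.  This file proves them for `U = {𝒰(C_s)}`, `𝒰` a monotone family of EDGE sets — instances of
`Consts.localEvE_fourEvents` (source sets `{s,y}` / `{s,y}` for `G_a`, `G_c` and `{s,y}` / `{s}` for `G_e`):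
* `Consts.pinnedEdge_exchange_Ga` — `(D∩Y∩U∖Z) × T → T' × (D∩Y∩U)`: `μ(s↔y, s↮z, s↮X, U)·μ(T) ≤ μ(T')·μ(s↔y, s↮X, U)`;
* `Consts.pinnedEdge_exchange_Gc` — `(D∩Y∩U∖Z) × (E₁∖U) → (E₁∖Z∖W∖U) × (D∩Y∩U)` (`E₁ = {{s,y}↮X}`);
* `Consts.pinnedEdge_exchange_Ge` — `(D∩Y∩U∖Z) × (D∩Z∖U) → (D∖Z∖U) × (D∩Y∩Z∩U)`;
* `Consts.crossRel_edge_M1_of_markerPinned` — **THEOREM: `P(X',X,X) + P(X,X',X) + P(X,X,X') ≥ 0` (`X' = X ∪ {z}`) for every weighted graph, all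
  `s, y, z, X` and every MONOTONE 0/1-valued functional `F` of the open edge cluster with `F(C_s) = 1 ⟹ s↔y`**, unconditionally.
[cite: VandenbergHaggstromKahn2005, Thm. 1.1 and its proof (pp. 3–5), Thm. 1.4 (p. 7) with Remark 1 after Thm. 1.2 (p. 5)]
-/

noncomputable section

namespace Summit.CriticalPhenomena.PercolationContinuityZ3.Theorems

open MeasureTheory Set Finset
open Literature.Probability.LatticeModels (prodBernoulli)
open Literature.Probability.Percolation
open scoped Classical

namespace Consts

variable {V : Type} [DecidableEq V] [Fintype V] (w : Sym2 V → unitInterval)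

omit [DecidableEq V] [Fintype V] in
/-- Reachability in the open graph is monotone in the configuration. [folklore] -/
private theorem reach_mono'' {ω ω' : BondConfig V} (h : ω ⊆ ω') {u v : V} (huv : (openGraph ω).Reachable u v) :
    (openGraph ω').Reachable u v :=
  huv.mono (BHK2006.openGraph_le h)

omit [DecidableEq V] [Fintype V] in
/-- The edge-cluster profile at a source. [folklore] -/
private theorem clusterOf_apply'' {S : Finset V} {ω : BondConfig V} {v : V} (hv : v ∈ S) :
    clusterOf S ω v = openEdgeCluster ω v := by
  ext e; exact ⟨fun h => h.2, fun h => ⟨hv, h⟩⟩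

omit [DecidableEq V] [Fintype V] in
/-- Reachability read off the edge cluster. [cite: VandenbergHaggstromKahn2005, §1 p. 3] -/
private theorem reach_iff'' (ω : BondConfig V) (v a : V) :
    (a = v ∨ ∃ e ∈ openEdgeCluster ω v, a ∈ e) ↔ (openGraph ω).Reachable v a :=
  (reachable_iff_exists_mem_openEdgeCluster ω v a).symm

/-- **Generator `G_a`** (`M₁` certificate): `μ(s↔y, s↮z, s↮X, 𝒰) · μ(y↮s, y↮X, s↮X) ≤ μ(y↮s, s↮z, y↮z, y↮X, s↮X) · μ(s↔y, s↮X, 𝒰)`.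
[cite: VandenbergHaggstromKahn2005, Thm. 1.1 and its proof (pp. 3–5) — instance of `Consts.localEvE_fourEvents`, derived here] -/
theorem pinnedEdge_exchange_Ga (s y z : V) (X : Set V) {𝒰 : Set (Sym2 V) → Prop} (h𝒰 : Monotone 𝒰) :
    (prodBernoulli w).real {ω : BondConfig V | (openGraph ω).Reachable s y ∧ ¬ (openGraph ω).Reachable s z ∧
        (∀ x ∈ X, ¬ (openGraph ω).Reachable s x) ∧ 𝒰 (openEdgeCluster ω s)} *
      (prodBernoulli w).real {ω : BondConfig V | ¬ (openGraph ω).Reachable y s ∧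
        (∀ x ∈ X, ¬ (openGraph ω).Reachable y x) ∧ (∀ x ∈ X, ¬ (openGraph ω).Reachable s x)} ≤
    (prodBernoulli w).real {ω : BondConfig V | ¬ (openGraph ω).Reachable y s ∧ ¬ (openGraph ω).Reachable s z ∧
        ¬ (openGraph ω).Reachable y z ∧ (∀ x ∈ X, ¬ (openGraph ω).Reachable y x) ∧ (∀ x ∈ X, ¬ (openGraph ω).Reachable s x)} *
      (prodBernoulli w).real {ω : BondConfig V | (openGraph ω).Reachable s y ∧ (∀ x ∈ X, ¬ (openGraph ω).Reachable s x) ∧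
        𝒰 (openEdgeCluster ω s)} := by
  set S : Finset V := {s, y} with hSdef
  have hsS : s ∈ S := by simp [hSdef]
  have hyS : y ∈ S := by simp [hSdef]
  have hRs : ∀ ω : BondConfig V, clusterOf S ω s = openEdgeCluster ω s := fun ω => clusterOf_apply'' hsS
  have hRy : ∀ ω : BondConfig V, clusterOf S ω y = openEdgeCluster ω y := fun ω => clusterOf_apply'' hyS
  have hball : ∀ (P : V → Prop), (∀ s' ∈ S, P s') ↔ (P s ∧ P y) := fun P => by
    simp only [hSdef, Finset.mem_insert, Finset.mem_singleton, forall_eq_or_imp, forall_eq]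
  let Φ₁ : (V → Set (Sym2 V)) → Prop := fun R => (y = s ∨ ∃ e ∈ R s, y ∈ e) ∧ ¬ (z = s ∨ ∃ e ∈ R s, z ∈ e) ∧ 𝒰 (R s)
  let Φ₂ : (V → Set (Sym2 V)) → Prop := fun R => ¬ (s = y ∨ ∃ e ∈ R y, s ∈ e)
  let Φ₃ : (V → Set (Sym2 V)) → Prop := fun R => ¬ (s = y ∨ ∃ e ∈ R y, s ∈ e) ∧ ¬ (z = s ∨ ∃ e ∈ R s, z ∈ e) ∧ ¬ (z = y ∨ ∃ e ∈ R y, z ∈ e)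
  let Φ₄ : (V → Set (Sym2 V)) → Prop := fun R => (y = s ∨ ∃ e ∈ R s, y ∈ e) ∧ 𝒰 (R s)
  have hAD : ∀ ω ω' : BondConfig V, Φ₁ (clusterOf S ω) → Φ₂ (clusterOf S ω') →
      Φ₃ (clusterOf (S ∩ S) (ω ∩ ω')) ∧ Φ₄ (clusterOf (S ∪ S) (ω ∪ ω')) := by
    intro ω ω' h1 h2
    simp only [Φ₁, Φ₂, Φ₃, Φ₄, Finset.inter_self, Finset.union_self, hRs, hRy, reach_iff''] at h1 h2 ⊢
    obtain ⟨hsy, hsz, hU⟩ := h1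
    refine ⟨⟨fun h => h2 (reach_mono'' Set.inter_subset_right h), fun h => hsz (reach_mono'' Set.inter_subset_left h),
      fun h => hsz (hsy.trans (reach_mono'' Set.inter_subset_left h))⟩, reach_mono'' Set.subset_union_left hsy,
      h𝒰 (BHK2006.openEdgeCluster_mono Set.subset_union_left s) hU⟩
  have key := localEvE_fourEvents w S S hAD X X
  rw [Finset.inter_self, Finset.union_self, Set.union_self, Set.inter_self] at key
  have e1 : ({ω : BondConfig V | Φ₁ (clusterOf S ω)} ∩ {ω | ∀ s' ∈ S, ∀ x ∈ X, ω ∉ openConn s' x}) =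
      {ω : BondConfig V | (openGraph ω).Reachable s y ∧ ¬ (openGraph ω).Reachable s z ∧
        (∀ x ∈ X, ¬ (openGraph ω).Reachable s x) ∧ 𝒰 (openEdgeCluster ω s)} := by
    ext ω
    simp only [Φ₁, Set.mem_inter_iff, Set.mem_setOf_eq, hRs, reach_iff'', hball, openConn]
    constructor
    · rintro ⟨⟨hsy, hsz, hU⟩, hsX, -⟩; exact ⟨hsy, hsz, hsX, hU⟩
    · rintro ⟨hsy, hsz, hsX, hU⟩; exact ⟨⟨hsy, hsz, hU⟩, hsX, fun x hx h' => hsX x hx (hsy.trans h')⟩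
  have e2 : ({ω : BondConfig V | Φ₂ (clusterOf S ω)} ∩ {ω | ∀ s' ∈ S, ∀ x ∈ X, ω ∉ openConn s' x}) =
      {ω : BondConfig V | ¬ (openGraph ω).Reachable y s ∧
        (∀ x ∈ X, ¬ (openGraph ω).Reachable y x) ∧ (∀ x ∈ X, ¬ (openGraph ω).Reachable s x)} := by
    ext ω
    simp only [Φ₂, Set.mem_inter_iff, Set.mem_setOf_eq, hRy, reach_iff'', hball, openConn]
    tauto
  have e3 : ({ω : BondConfig V | Φ₃ (clusterOf S ω)} ∩ {ω | ∀ s' ∈ S, ∀ x ∈ X, ω ∉ openConn s' x}) =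
      {ω : BondConfig V | ¬ (openGraph ω).Reachable y s ∧ ¬ (openGraph ω).Reachable s z ∧
        ¬ (openGraph ω).Reachable y z ∧ (∀ x ∈ X, ¬ (openGraph ω).Reachable y x) ∧ (∀ x ∈ X, ¬ (openGraph ω).Reachable s x)} := by
    ext ω
    simp only [Φ₃, Set.mem_inter_iff, Set.mem_setOf_eq, hRs, hRy, reach_iff'', hball, openConn]
    tauto
  have e4 : ({ω : BondConfig V | Φ₄ (clusterOf S ω)} ∩ {ω | ∀ s' ∈ S, ∀ x ∈ X, ω ∉ openConn s' x}) =
      {ω : BondConfig V | (openGraph ω).Reachable s y ∧ (∀ x ∈ X, ¬ (openGraph ω).Reachable s x) ∧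
        𝒰 (openEdgeCluster ω s)} := by
    ext ω
    simp only [Φ₄, Set.mem_inter_iff, Set.mem_setOf_eq, hRs, reach_iff'', hball, openConn]
    constructor
    · rintro ⟨⟨hsy, hU⟩, hsX, -⟩; exact ⟨hsy, hsX, hU⟩
    · rintro ⟨hsy, hsX, hU⟩; exact ⟨⟨hsy, hU⟩, hsX, fun x hx h' => hsX x hx (hsy.trans h')⟩
  rw [e1, e2, e3, e4] at key
  exact key

/-- **Generator `G_c`** (`M₁` certificate): `μ(s↔y, s↮z, s↮X, 𝒰) · μ({s,y}↮X, ¬𝒰) ≤ μ({s,y}↮X, s↮z, y↮z, ¬𝒰) · μ(s↔y, s↮X, 𝒰)`.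
[cite: VandenbergHaggstromKahn2005, Thm. 1.1 and its proof (pp. 3–5) — instance of `Consts.localEvE_fourEvents`, derived here] -/
theorem pinnedEdge_exchange_Gc (s y z : V) (X : Set V) {𝒰 : Set (Sym2 V) → Prop} (h𝒰 : Monotone 𝒰) :
    (prodBernoulli w).real {ω : BondConfig V | (openGraph ω).Reachable s y ∧ ¬ (openGraph ω).Reachable s z ∧
        (∀ x ∈ X, ¬ (openGraph ω).Reachable s x) ∧ 𝒰 (openEdgeCluster ω s)} *
      (prodBernoulli w).real {ω : BondConfig V | ¬ 𝒰 (openEdgeCluster ω s) ∧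
        (∀ x ∈ X, ¬ (openGraph ω).Reachable y x) ∧ (∀ x ∈ X, ¬ (openGraph ω).Reachable s x)} ≤
    (prodBernoulli w).real {ω : BondConfig V | ¬ (openGraph ω).Reachable s z ∧ ¬ (openGraph ω).Reachable y z ∧
        ¬ 𝒰 (openEdgeCluster ω s) ∧
        (∀ x ∈ X, ¬ (openGraph ω).Reachable y x) ∧ (∀ x ∈ X, ¬ (openGraph ω).Reachable s x)} *
      (prodBernoulli w).real {ω : BondConfig V | (openGraph ω).Reachable s y ∧ (∀ x ∈ X, ¬ (openGraph ω).Reachable s x) ∧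
        𝒰 (openEdgeCluster ω s)} := by
  set S : Finset V := {s, y} with hSdef
  have hsS : s ∈ S := by simp [hSdef]
  have hyS : y ∈ S := by simp [hSdef]
  have hRs : ∀ ω : BondConfig V, clusterOf S ω s = openEdgeCluster ω s := fun ω => clusterOf_apply'' hsS
  have hRy : ∀ ω : BondConfig V, clusterOf S ω y = openEdgeCluster ω y := fun ω => clusterOf_apply'' hyS
  have hball : ∀ (P : V → Prop), (∀ s' ∈ S, P s') ↔ (P s ∧ P y) := fun P => by
    simp only [hSdef, Finset.mem_insert, Finset.mem_singleton, forall_eq_or_imp, forall_eq]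
  let Φ₁ : (V → Set (Sym2 V)) → Prop := fun R => (y = s ∨ ∃ e ∈ R s, y ∈ e) ∧ ¬ (z = s ∨ ∃ e ∈ R s, z ∈ e) ∧ 𝒰 (R s)
  let Φ₂ : (V → Set (Sym2 V)) → Prop := fun R => ¬ 𝒰 (R s)
  let Φ₃ : (V → Set (Sym2 V)) → Prop := fun R => ¬ (z = s ∨ ∃ e ∈ R s, z ∈ e) ∧ ¬ (z = y ∨ ∃ e ∈ R y, z ∈ e) ∧ ¬ 𝒰 (R s)
  let Φ₄ : (V → Set (Sym2 V)) → Prop := fun R => (y = s ∨ ∃ e ∈ R s, y ∈ e) ∧ 𝒰 (R s)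
  have hAD : ∀ ω ω' : BondConfig V, Φ₁ (clusterOf S ω) → Φ₂ (clusterOf S ω') →
      Φ₃ (clusterOf (S ∩ S) (ω ∩ ω')) ∧ Φ₄ (clusterOf (S ∪ S) (ω ∪ ω')) := by
    intro ω ω' h1 h2
    simp only [Φ₁, Φ₂, Φ₃, Φ₄, Finset.inter_self, Finset.union_self, hRs, hRy, reach_iff''] at h1 h2 ⊢
    obtain ⟨hsy, hsz, hU⟩ := h1
    refine ⟨⟨fun h => hsz (reach_mono'' Set.inter_subset_left h), fun h => hsz (hsy.trans (reach_mono'' Set.inter_subset_left h)),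
      fun h => h2 (h𝒰 (BHK2006.openEdgeCluster_mono Set.inter_subset_right s) h)⟩,
      reach_mono'' Set.subset_union_left hsy,
      h𝒰 (BHK2006.openEdgeCluster_mono Set.subset_union_left s) hU⟩
  have key := localEvE_fourEvents w S S hAD X X
  rw [Finset.inter_self, Finset.union_self, Set.union_self, Set.inter_self] at key
  have e1 : ({ω : BondConfig V | Φ₁ (clusterOf S ω)} ∩ {ω | ∀ s' ∈ S, ∀ x ∈ X, ω ∉ openConn s' x}) =
      {ω : BondConfig V | (openGraph ω).Reachable s y ∧ ¬ (openGraph ω).Reachable s z ∧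
        (∀ x ∈ X, ¬ (openGraph ω).Reachable s x) ∧ 𝒰 (openEdgeCluster ω s)} := by
    ext ω
    simp only [Φ₁, Set.mem_inter_iff, Set.mem_setOf_eq, hRs, reach_iff'', hball, openConn]
    constructor
    · rintro ⟨⟨hsy, hsz, hU⟩, hsX, -⟩; exact ⟨hsy, hsz, hsX, hU⟩
    · rintro ⟨hsy, hsz, hsX, hU⟩; exact ⟨⟨hsy, hsz, hU⟩, hsX, fun x hx h' => hsX x hx (hsy.trans h')⟩
  have e2 : ({ω : BondConfig V | Φ₂ (clusterOf S ω)} ∩ {ω | ∀ s' ∈ S, ∀ x ∈ X, ω ∉ openConn s' x}) =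
      {ω : BondConfig V | ¬ 𝒰 (openEdgeCluster ω s) ∧
        (∀ x ∈ X, ¬ (openGraph ω).Reachable y x) ∧ (∀ x ∈ X, ¬ (openGraph ω).Reachable s x)} := by
    ext ω
    simp only [Φ₂, Set.mem_inter_iff, Set.mem_setOf_eq, hRs, hball, openConn]
    tauto
  have e3 : ({ω : BondConfig V | Φ₃ (clusterOf S ω)} ∩ {ω | ∀ s' ∈ S, ∀ x ∈ X, ω ∉ openConn s' x}) =
      {ω : BondConfig V | ¬ (openGraph ω).Reachable s z ∧ ¬ (openGraph ω).Reachable y z ∧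
        ¬ 𝒰 (openEdgeCluster ω s) ∧
        (∀ x ∈ X, ¬ (openGraph ω).Reachable y x) ∧ (∀ x ∈ X, ¬ (openGraph ω).Reachable s x)} := by
    ext ω
    simp only [Φ₃, Set.mem_inter_iff, Set.mem_setOf_eq, hRs, hRy, reach_iff'', hball, openConn]
    tauto
  have e4 : ({ω : BondConfig V | Φ₄ (clusterOf S ω)} ∩ {ω | ∀ s' ∈ S, ∀ x ∈ X, ω ∉ openConn s' x}) =
      {ω : BondConfig V | (openGraph ω).Reachable s y ∧ (∀ x ∈ X, ¬ (openGraph ω).Reachable s x) ∧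
        𝒰 (openEdgeCluster ω s)} := by
    ext ω
    simp only [Φ₄, Set.mem_inter_iff, Set.mem_setOf_eq, hRs, reach_iff'', hball, openConn]
    constructor
    · rintro ⟨⟨hsy, hU⟩, hsX, -⟩; exact ⟨hsy, hsX, hU⟩
    · rintro ⟨hsy, hsX, hU⟩; exact ⟨⟨hsy, hU⟩, hsX, fun x hx h' => hsX x hx (hsy.trans h')⟩
  rw [e1, e2, e3, e4] at key
  exact key

/-- **Generator `G_e`** (`M₁` certificate; source sets `{s,y}` and `{s}`): `μ(s↔y, s↮z, s↮X, 𝒰) · μ(s↔z, s↮X, ¬𝒰) ≤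
μ(s↮z, s↮X, ¬𝒰) · μ(s↔y, s↔z, s↮X, 𝒰)`.
[cite: VandenbergHaggstromKahn2005, Thm. 1.1 and its proof (pp. 3–5) — instance of `Consts.localEvE_fourEvents`, derived here] -/
theorem pinnedEdge_exchange_Ge (s y z : V) (X : Set V) {𝒰 : Set (Sym2 V) → Prop} (h𝒰 : Monotone 𝒰) :
    (prodBernoulli w).real {ω : BondConfig V | (openGraph ω).Reachable s y ∧ ¬ (openGraph ω).Reachable s z ∧
        (∀ x ∈ X, ¬ (openGraph ω).Reachable s x) ∧ 𝒰 (openEdgeCluster ω s)} *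
      (prodBernoulli w).real {ω : BondConfig V | (openGraph ω).Reachable s z ∧ (∀ x ∈ X, ¬ (openGraph ω).Reachable s x) ∧
        ¬ 𝒰 (openEdgeCluster ω s)} ≤
    (prodBernoulli w).real {ω : BondConfig V | ¬ (openGraph ω).Reachable s z ∧ (∀ x ∈ X, ¬ (openGraph ω).Reachable s x) ∧
        ¬ 𝒰 (openEdgeCluster ω s)} *
      (prodBernoulli w).real {ω : BondConfig V | (openGraph ω).Reachable s y ∧ (openGraph ω).Reachable s z ∧
        (∀ x ∈ X, ¬ (openGraph ω).Reachable s x) ∧ 𝒰 (openEdgeCluster ω s)} := by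
  set S₁ : Finset V := {s, y} with hS₁
  set S₂ : Finset V := {s} with hS₂
  have hsS₁ : s ∈ S₁ := by simp [hS₁]
  have hsS₂ : s ∈ S₂ := by simp [hS₂]
  have h12 : S₁ ∩ S₂ = S₂ := by ext v; simp [hS₁, hS₂]
  have h21 : S₁ ∪ S₂ = S₁ := by ext v; simp only [hS₁, hS₂, Finset.mem_union, Finset.mem_insert, Finset.mem_singleton]; tauto
  have hR₁ : ∀ ω : BondConfig V, clusterOf S₁ ω s = openEdgeCluster ω s := fun ω => clusterOf_apply'' hsS₁
  have hR₂ : ∀ ω : BondConfig V, clusterOf S₂ ω s = openEdgeCluster ω s := fun ω => clusterOf_apply'' hsS₂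
  have hball₁ : ∀ (P : V → Prop), (∀ s' ∈ S₁, P s') ↔ (P s ∧ P y) := fun P => by
    simp only [hS₁, Finset.mem_insert, Finset.mem_singleton, forall_eq_or_imp, forall_eq]
  have hball₂ : ∀ (P : V → Prop), (∀ s' ∈ S₂, P s') ↔ P s := fun P => by
    simp only [hS₂, Finset.mem_singleton, forall_eq]
  let Φ₁ : (V → Set (Sym2 V)) → Prop := fun R => (y = s ∨ ∃ e ∈ R s, y ∈ e) ∧ ¬ (z = s ∨ ∃ e ∈ R s, z ∈ e) ∧ 𝒰 (R s)
  let Φ₂ : (V → Set (Sym2 V)) → Prop := fun R => (z = s ∨ ∃ e ∈ R s, z ∈ e) ∧ ¬ 𝒰 (R s)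
  let Φ₃ : (V → Set (Sym2 V)) → Prop := fun R => ¬ (z = s ∨ ∃ e ∈ R s, z ∈ e) ∧ ¬ 𝒰 (R s)
  let Φ₄ : (V → Set (Sym2 V)) → Prop := fun R => (y = s ∨ ∃ e ∈ R s, y ∈ e) ∧ (z = s ∨ ∃ e ∈ R s, z ∈ e) ∧ 𝒰 (R s)
  have hAD : ∀ ω ω' : BondConfig V, Φ₁ (clusterOf S₁ ω) → Φ₂ (clusterOf S₂ ω') →
      Φ₃ (clusterOf (S₁ ∩ S₂) (ω ∩ ω')) ∧ Φ₄ (clusterOf (S₁ ∪ S₂) (ω ∪ ω')) := by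
    intro ω ω' h1 h2
    rw [h12, h21]
    simp only [Φ₁, Φ₂, Φ₃, Φ₄, hR₁, hR₂, reach_iff''] at h1 h2 ⊢
    obtain ⟨hsy, hsz, hU⟩ := h1
    obtain ⟨hsz', hU'⟩ := h2
    refine ⟨⟨fun h => hsz (reach_mono'' Set.inter_subset_left h),
      fun h => hU' (h𝒰 (BHK2006.openEdgeCluster_mono Set.inter_subset_right s) h)⟩,
      reach_mono'' Set.subset_union_left hsy, reach_mono'' Set.subset_union_right hsz',
      h𝒰 (BHK2006.openEdgeCluster_mono Set.subset_union_left s) hU⟩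
  have key := localEvE_fourEvents w S₁ S₂ hAD X X
  rw [h12, h21, Set.union_self, Set.inter_self] at key
  have e1 : ({ω : BondConfig V | Φ₁ (clusterOf S₁ ω)} ∩ {ω | ∀ s' ∈ S₁, ∀ x ∈ X, ω ∉ openConn s' x}) =
      {ω : BondConfig V | (openGraph ω).Reachable s y ∧ ¬ (openGraph ω).Reachable s z ∧
        (∀ x ∈ X, ¬ (openGraph ω).Reachable s x) ∧ 𝒰 (openEdgeCluster ω s)} := by
    ext ω
    simp only [Φ₁, Set.mem_inter_iff, Set.mem_setOf_eq, hR₁, reach_iff'', hball₁, openConn]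
    constructor
    · rintro ⟨⟨hsy, hsz, hU⟩, hsX, -⟩; exact ⟨hsy, hsz, hsX, hU⟩
    · rintro ⟨hsy, hsz, hsX, hU⟩; exact ⟨⟨hsy, hsz, hU⟩, hsX, fun x hx h' => hsX x hx (hsy.trans h')⟩
  have e2 : ({ω : BondConfig V | Φ₂ (clusterOf S₂ ω)} ∩ {ω | ∀ s' ∈ S₂, ∀ x ∈ X, ω ∉ openConn s' x}) =
      {ω : BondConfig V | (openGraph ω).Reachable s z ∧ (∀ x ∈ X, ¬ (openGraph ω).Reachable s x) ∧
        ¬ 𝒰 (openEdgeCluster ω s)} := by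
    ext ω
    simp only [Φ₂, Set.mem_inter_iff, Set.mem_setOf_eq, hR₂, reach_iff'', hball₂, openConn]
    tauto
  have e3 : ({ω : BondConfig V | Φ₃ (clusterOf S₂ ω)} ∩ {ω | ∀ s' ∈ S₂, ∀ x ∈ X, ω ∉ openConn s' x}) =
      {ω : BondConfig V | ¬ (openGraph ω).Reachable s z ∧ (∀ x ∈ X, ¬ (openGraph ω).Reachable s x) ∧
        ¬ 𝒰 (openEdgeCluster ω s)} := by
    ext ω
    simp only [Φ₃, Set.mem_inter_iff, Set.mem_setOf_eq, hR₂, reach_iff'', hball₂, openConn]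
    tauto
  have e4 : ({ω : BondConfig V | Φ₄ (clusterOf S₁ ω)} ∩ {ω | ∀ s' ∈ S₁, ∀ x ∈ X, ω ∉ openConn s' x}) =
      {ω : BondConfig V | (openGraph ω).Reachable s y ∧ (openGraph ω).Reachable s z ∧
        (∀ x ∈ X, ¬ (openGraph ω).Reachable s x) ∧ 𝒰 (openEdgeCluster ω s)} := by
    ext ω
    simp only [Φ₄, Set.mem_inter_iff, Set.mem_setOf_eq, hR₁, reach_iff'', hball₁, openConn]
    constructor
    · rintro ⟨⟨hsy, hsz, hU⟩, hsX, -⟩; exact ⟨hsy, hsz, hsX, hU⟩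
    · rintro ⟨hsy, hsz, hsX, hU⟩; exact ⟨⟨hsy, hsz, hU⟩, hsX, fun x hx h' => hsX x hx (hsy.trans h')⟩
  rw [e1, e2, e3, e4] at key
  exact key

/-- **CROSS member `M₁` at `u = z` on the marker-pinned class, unconditionally** (`…CrossReachMarkerPinnedEventM1`'s theorem with its three
exchange hypotheses discharged by `pinnedEdge_exchange_Ga/Gc/Ge`). [cite: VandenbergHaggstromKahn2005, Thm. 1.1 (pp. 3–5), Thm. 1.4 (p. 7)] -/
theorem crossRel_edge_M1_of_markerPinned (s y z : V) (X : Set V) (F : Set (Sym2 V) → ℝ) (hFm : Monotone F)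
    (hF01 : ∀ C, F C = 0 ∨ F C = 1) (hFY : ∀ ω : BondConfig V, F (openEdgeCluster ω s) = 1 → (openGraph ω).Reachable s y) :
    0 ≤ polMargin (prodBernoulli w) s y z F (insert z X) X X +
          polMargin (prodBernoulli w) s y z F X (insert z X) X +
        polMargin (prodBernoulli w) s y z F X X (insert z X) := by
  -- the up-set `𝒰 = {F = 1}` of edge clusters and the event `U = {F(C_s) = 1} ⊆ {s↔y}`
  set 𝒰 : Set (Sym2 V) → Prop := fun C => F C = 1 with h𝒰def
  have h𝒰 : Monotone 𝒰 := by
    intro C C' hCC' hC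
    have h1 : F C ≤ F C' := hFm hCC'
    rcases hF01 C' with h' | h'
    · exfalso; simp only [h𝒰def] at hC; linarith
    · exact h'
  set U : Set (BondConfig V) := {ω | 𝒰 (openEdgeCluster ω s)} with hUdef
  have hUY : U ⊆ openConn s y := fun ω hω => hFY ω hω
  have hF : ∀ ω : BondConfig V, F (openEdgeCluster ω s) = U.indicator 1 ω := by
    intro ω
    rcases hF01 (openEdgeCluster ω s) with h | h
    · have hn : ω ∉ U := by simp only [hUdef, h𝒰def, Set.mem_setOf_eq, h]; norm_num
      rw [h, Set.indicator_of_notMem hn]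
    · rw [Set.indicator_of_mem (show ω ∈ U from h), Pi.one_apply, h]
  have ga := pinnedEdge_exchange_Ga w s y z X h𝒰
  have gc := pinnedEdge_exchange_Gc w s y z X h𝒰
  have ge := pinnedEdge_exchange_Ge w s y z X h𝒰
  have e_YZcU : {ω : BondConfig V | (openGraph ω).Reachable s y ∧ ¬ (openGraph ω).Reachable s z ∧
        (∀ x ∈ X, ¬ (openGraph ω).Reachable s x) ∧ 𝒰 (openEdgeCluster ω s)} =
      ({ω : BondConfig V | ∀ x ∈ X, ¬ (openGraph ω).Reachable s x} ∩ openConn s y ∩ U) \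
        openConn s z := by
    ext ω; simp only [hUdef, Set.mem_inter_iff, Set.mem_sdiff, Set.mem_setOf_eq, openConn]; tauto
  have e_T : {ω : BondConfig V | ¬ (openGraph ω).Reachable y s ∧
        (∀ x ∈ X, ¬ (openGraph ω).Reachable y x) ∧ (∀ x ∈ X, ¬ (openGraph ω).Reachable s x)} =
      {ω : BondConfig V | ∀ x ∈ insert s X, ¬ (openGraph ω).Reachable y x} ∩ {ω | ∀ x ∈ X, ¬ (openGraph ω).Reachable s x} := by
    ext ω; simp only [Set.mem_inter_iff, Set.mem_setOf_eq, Set.forall_mem_insert]; tauto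
  have e_T' : {ω : BondConfig V | ¬ (openGraph ω).Reachable y s ∧ ¬ (openGraph ω).Reachable s z ∧
        ¬ (openGraph ω).Reachable y z ∧ (∀ x ∈ X, ¬ (openGraph ω).Reachable y x) ∧ (∀ x ∈ X, ¬ (openGraph ω).Reachable s x)} =
      {ω : BondConfig V | ∀ x ∈ insert s (insert z X), ¬ (openGraph ω).Reachable y x} ∩
        {ω | ∀ x ∈ insert z X, ¬ (openGraph ω).Reachable s x} := by
    ext ω; simp only [Set.mem_inter_iff, Set.mem_setOf_eq, Set.forall_mem_insert]; tauto
  have e_YU : {ω : BondConfig V | (openGraph ω).Reachable s y ∧ (∀ x ∈ X, ¬ (openGraph ω).Reachable s x) ∧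
        𝒰 (openEdgeCluster ω s)} =
      {ω : BondConfig V | ∀ x ∈ X, ¬ (openGraph ω).Reachable s x} ∩ openConn s y ∩ U := by
    ext ω; simp only [hUdef, Set.mem_inter_iff, Set.mem_setOf_eq, openConn]; tauto
  have e_E₁u : {ω : BondConfig V | ¬ 𝒰 (openEdgeCluster ω s) ∧
        (∀ x ∈ X, ¬ (openGraph ω).Reachable y x) ∧ (∀ x ∈ X, ¬ (openGraph ω).Reachable s x)} =
      ({ω : BondConfig V | ∀ x ∈ X, ¬ (openGraph ω).Reachable y x} ∩ {ω | ∀ x ∈ X, ¬ (openGraph ω).Reachable s x}) \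
        U := by
    ext ω; simp only [Set.mem_inter_iff, Set.mem_sdiff, Set.mem_setOf_eq]; tauto
  have e_Mc : {ω : BondConfig V | ¬ (openGraph ω).Reachable s z ∧ ¬ (openGraph ω).Reachable y z ∧
        ¬ 𝒰 (openEdgeCluster ω s) ∧
        (∀ x ∈ X, ¬ (openGraph ω).Reachable y x) ∧ (∀ x ∈ X, ¬ (openGraph ω).Reachable s x)} =
      (((({ω : BondConfig V | ∀ x ∈ X, ¬ (openGraph ω).Reachable y x} ∩ {ω | ∀ x ∈ X, ¬ (openGraph ω).Reachable s x}) \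
          U) \ openConn s z) \ openConn y z) := by
    ext ω; simp only [hUdef, Set.mem_inter_iff, Set.mem_sdiff, Set.mem_setOf_eq, openConn]; tauto
  have e_Zu : {ω : BondConfig V | (openGraph ω).Reachable s z ∧ (∀ x ∈ X, ¬ (openGraph ω).Reachable s x) ∧
        ¬ 𝒰 (openEdgeCluster ω s)} =
      ({ω : BondConfig V | ∀ x ∈ X, ¬ (openGraph ω).Reachable s x} ∩ openConn s z) \ U := by
    ext ω; simp only [hUdef, Set.mem_inter_iff, Set.mem_sdiff, Set.mem_setOf_eq, openConn]; tauto
  have e_zu : {ω : BondConfig V | ¬ (openGraph ω).Reachable s z ∧ (∀ x ∈ X, ¬ (openGraph ω).Reachable s x) ∧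
        ¬ 𝒰 (openEdgeCluster ω s)} =
      ({ω : BondConfig V | ∀ x ∈ X, ¬ (openGraph ω).Reachable s x} \ openConn s z) \ U := by
    ext ω; simp only [Set.mem_sdiff, Set.mem_setOf_eq, openConn]; tauto
  have e_YZU : {ω : BondConfig V | (openGraph ω).Reachable s y ∧ (openGraph ω).Reachable s z ∧
        (∀ x ∈ X, ¬ (openGraph ω).Reachable s x) ∧ 𝒰 (openEdgeCluster ω s)} =
      {ω : BondConfig V | ∀ x ∈ X, ¬ (openGraph ω).Reachable s x} ∩ openConn s y ∩
        U ∩ openConn s z := by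
    ext ω; simp only [hUdef, Set.mem_inter_iff, Set.mem_setOf_eq, openConn]; tauto
  rw [e_YZcU, e_T, e_T', e_YU] at ga
  rw [e_YZcU, e_E₁u, e_Mc, e_YU] at gc
  rw [e_YZcU, e_Zu, e_zu, e_YZU] at ge
  exact crossRel_M1_of_pinnedEvent_of_exchanges w s y z X U hUY F hF ga gc ge


end Consts

end Summit.CriticalPhenomena.PercolationContinuityZ3.Theorems

end
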